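import Mathlib
import Literature.NumberTheory.Sieve.Maynard2016Lemma7Reduction
import HarnessLib

/-!
# Maynard 2016: growth facts for the parameters `w, P_w, y, z, U` (W-trick plumbing)

Topic `Literature/NumberTheory/Sieve`. J. Maynard, *Large gaps between primes*, Ann. of Math. (2)
183 (2016), 915–933 = arXiv:1408.5110, §2 display (2.1) (`y, z, U`) and §4 (`w = log₄ x`,
`P_w = ∏_{p ≤ w} p = o(log₂ x)`, `h_j = p_{π(k)+j} P_w`).

PROVED elementary facts used throughout §§6–7 (the evaluations of Lemma 6 and of displays
(6.22)–(6.31)): for all large `x` the iterated logarithms are `≥ 1` and ordered, `P_w ≤ (log₃ x)³`,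
`w ≤ z`, `w + 1 ≤ y` (so `P_w ∣ P_y`), `log y > 0`, `U > 0`; a prime `> w` is coprime to `P_w`;
`P_w ∣ h_i`, the `h_i` are distinct; `ω_{m,q}(p) ≤ p`, `𝔖_{m,q} ≥ 0`, and the main term `M_{m,q}`
of Lemma 6 (`normMain`) is `≥ 0`. No new named facts.

## References

* J. Maynard, *Large gaps between primes*, Ann. of Math. (2) 183 (2016), 915–933; arXiv:1408.5110,
  §2 (2.1), §4, §5 (5.1)–(5.2). [Maynard2016LargeGaps]
-/

open Filter Finset
open scoped Topology

namespace Literature.NumberTheory.Sieve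

namespace Maynard2016

/-! ### Iterated logarithms along `x → ∞` -/

/-- `log t ≤ t` for `t ≥ 0`. [folklore] -/
private theorem log_le_self' {t : ℝ} (ht : 0 ≤ t) : Real.log t ≤ t := by
  rcases ht.eq_or_lt with h | h
  · rw [← h, Real.log_zero]
  · linarith [Real.log_le_sub_one_of_pos h]

/-- `log t ≤ t/2` for `t > 0`. [folklore] -/
private theorem log_le_half {t : ℝ} (ht : 0 < t) : Real.log t ≤ t / 2 := by
  have h1 := Real.log_le_sub_one_of_pos (half_pos ht)
  have h2 : Real.log 2 ≤ 2 - 1 := Real.log_le_sub_one_of_pos two_pos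
  have h3 : Real.log (t / 2) = Real.log t - Real.log 2 := Real.log_div ht.ne' two_ne_zero
  linarith

/-- **Growth facts along `x : ℕ → ∞`**: `log x ≥ 4`, `log₂ x ≥ 2`, `log₃ x ≥ 1`,
`log₃ x ≤ log₂ x − 1`, `log₂ x ≤ log x − 1`, `log x ≤ x`, `(log x)² ≤ x`. [cite: Maynard2016LargeGaps, §2 display (2.1)] -/
theorem eventually_iteratedLogs :
    ∀ᶠ x : ℕ in atTop, 4 ≤ Real.log x ∧ 2 ≤ Real.log (Real.log x) ∧
      1 ≤ Real.log (Real.log (Real.log x)) ∧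
      Real.log (Real.log (Real.log x)) ≤ Real.log (Real.log x) - 1 ∧
      Real.log (Real.log x) ≤ Real.log x - 1 ∧ Real.log x ≤ x ∧ (Real.log x) ^ 2 ≤ x := by
  have hT₁ : Tendsto (fun X : ℝ => Real.log X) atTop atTop := Real.tendsto_log_atTop
  have hT₂ : Tendsto (fun X : ℝ => Real.log (Real.log X)) atTop atTop :=
    Real.tendsto_log_atTop.comp hT₁
  have hT₃ : Tendsto (fun X : ℝ => Real.log (Real.log (Real.log X))) atTop atTop :=
    Real.tendsto_log_atTop.comp hT₂
  have hsq := (Real.isLittleO_pow_log_id_atTop (n := 2)).bound (show (0 : ℝ) < 1 by norm_num)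
  have hreal : ∀ᶠ X : ℝ in atTop, 4 ≤ Real.log X ∧ 2 ≤ Real.log (Real.log X) ∧
      1 ≤ Real.log (Real.log (Real.log X)) ∧
      Real.log (Real.log (Real.log X)) ≤ Real.log (Real.log X) - 1 ∧
      Real.log (Real.log X) ≤ Real.log X - 1 ∧ Real.log X ≤ X ∧ (Real.log X) ^ 2 ≤ X := by
    filter_upwards [hT₁.eventually_ge_atTop 4, hT₂.eventually_ge_atTop 2,
      hT₃.eventually_ge_atTop 1, eventually_ge_atTop (0 : ℝ), hsq] with X hL hL₂ hL₃ hX0 hsqX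
    have hL0 : 0 < Real.log X := by linarith
    have hL₂0 : 0 < Real.log (Real.log X) := by linarith
    refine ⟨hL, hL₂, hL₃, Real.log_le_sub_one_of_pos hL₂0, Real.log_le_sub_one_of_pos hL0,
      log_le_self' hX0, ?_⟩
    rw [Real.norm_eq_abs, Real.norm_eq_abs, id, one_mul, abs_of_nonneg (sq_nonneg _),
      abs_of_nonneg hX0] at hsqX
    exact hsqX
  exact tendsto_natCast_atTop_atTop.eventually hreal

/-! ### `w` and `P_w` -/

/-- `w ≥ 0` once `log₃ x ≥ 1`. [cite: Maynard2016LargeGaps, §4 (choice of w)] -/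
theorem wFun_nonneg {x : ℕ} (hL₃ : 1 ≤ Real.log (Real.log (Real.log x))) : 0 ≤ wFun x := by
  unfold wFun
  exact Real.log_nonneg hL₃

/-- `w ≤ log₃ x − 1` once `log₃ x > 0`. [cite: Maynard2016LargeGaps, §4 (choice of w)] -/
theorem wFun_le {x : ℕ} (hL₃ : 0 < Real.log (Real.log (Real.log x))) :
    wFun x ≤ Real.log (Real.log (Real.log x)) - 1 := by
  unfold wFun
  exact Real.log_le_sub_one_of_pos hL₃

/-- `P_w ≤ (log₃ x)³` once `log₃ x ≥ 1` (`P_w ≤ 4^w`, `w = log₄ x`, `log 4 ≤ 3`); in particular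
`P_w = o(log₂ x)`. [cite: Maynard2016LargeGaps, §4 («such that P_w = o(log₂ x)»)] -/
theorem Pw_le_log₃_pow {x : ℕ} (hL₃ : 1 ≤ Real.log (Real.log (Real.log x))) :
    (Pw x : ℝ) ≤ (Real.log (Real.log (Real.log x))) ^ 3 := by
  set L₃ := Real.log (Real.log (Real.log x)) with hL₃def
  have hL₃0 : 0 < L₃ := by linarith
  have hw0 : 0 ≤ wFun x := by
    unfold wFun; rw [← hL₃def]; exact Real.log_nonneg hL₃
  have h1 : (Pw x : ℝ) ≤ (4 : ℝ) ^ (⌊wFun x⌋₊ : ℝ) := by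
    rw [Real.rpow_natCast]
    unfold Pw
    exact_mod_cast primorial_le_four_pow _
  have h2 : (4 : ℝ) ^ (⌊wFun x⌋₊ : ℝ) ≤ (4 : ℝ) ^ (wFun x) :=
    Real.rpow_le_rpow_of_exponent_le (by norm_num) (Nat.floor_le hw0)
  have h3 : (4 : ℝ) ^ (wFun x) ≤ Real.exp (3 * wFun x) := by
    rw [Real.rpow_def_of_pos (by norm_num : (0 : ℝ) < 4)]
    apply Real.exp_le_exp.2
    have h4 : Real.log 4 ≤ 3 := by
      have := Real.log_le_sub_one_of_pos (show (0 : ℝ) < 4 by norm_num); linarith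
    nlinarith
  have h4 : Real.exp (3 * wFun x) = L₃ ^ 3 := by
    unfold wFun; rw [← hL₃def, ← Real.exp_log hL₃0]
    rw [Real.log_exp, ← Real.exp_nat_mul]; norm_num
  linarith [h4.le]

/-- A prime `p > w` is coprime to `P_w`. [cite: Maynard2016LargeGaps, §4 (definition of P_w)] -/
theorem coprime_Pw_of_prime_gt {p x : ℕ} (hp : p.Prime) (h : wFun x < p) :
    Nat.Coprime p (Pw x) := by
  rw [Nat.Prime.coprime_iff_not_dvd hp]
  unfold Pw
  rw [hp.dvd_primorial_iff]
  intro hle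
  rcases le_or_gt 0 (wFun x) with hw | hw
  · have h1 : (p : ℝ) ≤ ⌊wFun x⌋₊ := by exact_mod_cast hle
    have h2 : ((⌊wFun x⌋₊ : ℕ) : ℝ) ≤ wFun x := Nat.floor_le hw
    linarith
  · rw [Nat.floor_of_nonpos hw.le] at hle
    exact hp.ne_zero (Nat.le_zero.1 hle)

/-- `P_w ∣ h_i`. [cite: Maynard2016LargeGaps, §4 (definition of h_j)] -/
theorem Pw_dvd_hTuple (k x : ℕ) (i : Fin k) : Pw x ∣ hTuple k x i :=
  Dvd.intro_left _ rfl

/-- `h_i ≥ 1`. [cite: Maynard2016LargeGaps, §4 (definition of h_j)] -/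
theorem one_le_hTuple (k x : ℕ) (i : Fin k) : 1 ≤ hTuple k x i := by
  unfold hTuple Pw
  exact Nat.one_le_iff_ne_zero.2 (Nat.mul_ne_zero (Nat.prime_nth_prime _).ne_zero
    (primorial_pos _).ne')

/-- The `h_i` are distinct. [cite: Maynard2016LargeGaps, §4 (definition of h_j)] -/
theorem hTuple_injective (k x : ℕ) : Function.Injective (hTuple k x) := by
  intro i j h
  unfold hTuple at h
  have hP : 0 < Pw x := primorial_pos _
  have h1 : Nat.nth Nat.Prime (Nat.primeCounting k + i) =
      Nat.nth Nat.Prime (Nat.primeCounting k + j) := Nat.eq_of_mul_eq_mul_right hP h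
  have h2 := (Nat.nth_injective Nat.infinite_setOf_prime) h1
  exact Fin.ext (by omega)

/-- `P_w ∣ ∏_{p ≤ Y} p` whenever `w ≤ Y` (used with `Y = y`: `P_w ∣ P_y`). [cite: Maynard2016LargeGaps, §4 (definition of P_w)] -/
theorem Pw_dvd_primorial_floor {x : ℕ} {Y : ℝ} (h : wFun x ≤ Y) : Pw x ∣ primorial ⌊Y⌋₊ :=
  primorial_dvd_primorial (Nat.floor_mono h)

/-! ### `y`, `z`, `U` -/

/-- `log y ≥ 0` for `ε ≤ 1` once the iterated logarithms are non-negative. [cite: Maynard2016LargeGaps, §2 display (2.1)] -/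
theorem log_y_nonneg {ε : ℝ} (hε : ε ≤ 1) {x : ℕ} (hL : 0 ≤ Real.log x)
    (hL₂ : 0 ≤ Real.log (Real.log x)) (hL₃ : 0 ≤ Real.log (Real.log (Real.log x))) :
    0 ≤ Real.log (y ε x) := by
  rw [log_y]
  exact mul_nonneg (by linarith) (div_nonneg (mul_nonneg hL hL₃) hL₂)

/-- `log y ≥ (log₃ x)/2` for `ε ≤ 1/2` (once `0 < log₂ x ≤ log x`, `log₃ x ≥ 0`).
[cite: Maynard2016LargeGaps, §2 display (2.1)] -/
theorem half_log₃_le_log_y {ε : ℝ} (hε : ε ≤ 1 / 2) {x : ℕ} (hL₂ : 0 < Real.log (Real.log x))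
    (hL₂L : Real.log (Real.log x) ≤ Real.log x) (hL₃ : 0 ≤ Real.log (Real.log (Real.log x))) :
    Real.log (Real.log (Real.log x)) / 2 ≤ Real.log (y ε x) := by
  rw [log_y]
  have h1 : Real.log (Real.log (Real.log x)) ≤
      Real.log x * Real.log (Real.log (Real.log x)) / Real.log (Real.log x) := by
    rw [le_div_iff₀ hL₂]
    nlinarith
  nlinarith

/-- `log y > 0` for `ε ≤ 1/2` once `log₃ x ≥ 1` etc. [cite: Maynard2016LargeGaps, §2 display (2.1)] -/
theorem log_y_pos {ε : ℝ} (hε : ε ≤ 1 / 2) {x : ℕ} (hL₂ : 0 < Real.log (Real.log x))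
    (hL₂L : Real.log (Real.log x) ≤ Real.log x) (hL₃ : 1 ≤ Real.log (Real.log (Real.log x))) :
    0 < Real.log (y ε x) := by
  have := half_log₃_le_log_y hε hL₂ hL₂L (by linarith)
  linarith

/-- `w + 1 ≤ log₃ x ≤ y` for `ε ≤ 1/2` (so `⌊w⌋ ≤ ⌊y⌋` and `P_w ∣ P_y`). [cite: Maynard2016LargeGaps, §2 display (2.1), §4] -/
theorem wFun_add_one_le_y {ε : ℝ} (hε : ε ≤ 1 / 2) {x : ℕ} (hL₂ : 0 < Real.log (Real.log x))
    (hL₂L : Real.log (Real.log x) ≤ Real.log x) (hL₃ : 1 ≤ Real.log (Real.log (Real.log x))) :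
    wFun x + 1 ≤ y ε x := by
  set L₃ := Real.log (Real.log (Real.log x)) with hL₃def
  have hL₃0 : 0 < L₃ := by linarith
  have h1 : wFun x ≤ L₃ - 1 := wFun_le hL₃0
  have h2 : Real.log L₃ ≤ Real.log (y ε x) :=
    (log_le_half hL₃0).trans (half_log₃_le_log_y hε hL₂ hL₂L hL₃0.le)
  have h3 : L₃ ≤ y ε x := by
    have := Real.exp_le_exp.2 h2
    rwa [Real.exp_log hL₃0, show Real.exp (Real.log (y ε x)) = y ε x from
      Real.exp_log (Real.exp_pos _)] at this
  linarith

/-- `P_w ∣ P_y` for `ε ≤ 1/2` and large `x`. [cite: Maynard2016LargeGaps, §4 (definition of P_w)] -/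
theorem Pw_dvd_Py {ε : ℝ} (hε : ε ≤ 1 / 2) {x : ℕ} (hL₂ : 0 < Real.log (Real.log x))
    (hL₂L : Real.log (Real.log x) ≤ Real.log x) (hL₃ : 1 ≤ Real.log (Real.log (Real.log x))) :
    Pw x ∣ primorial ⌊y ε x⌋₊ :=
  Pw_dvd_primorial_floor (by linarith [wFun_add_one_le_y hε hL₂ hL₂L hL₃])

/-- `w ≤ z` once `1 ≤ log₃ x ≤ log₂ x ≤ log x` and `(log x)² ≤ x`. [cite: Maynard2016LargeGaps, §2 display (2.1), §4] -/
theorem wFun_le_z {x : ℕ} (hL₂ : 0 < Real.log (Real.log x))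
    (hL₃L₂ : Real.log (Real.log (Real.log x)) ≤ Real.log (Real.log x))
    (hL₂L : Real.log (Real.log x) ≤ Real.log x) (hL₃ : 1 ≤ Real.log (Real.log (Real.log x)))
    (hsq : (Real.log x) ^ 2 ≤ x) : wFun x ≤ z x := by
  have h1 : wFun x ≤ Real.log (Real.log (Real.log x)) - 1 := wFun_le (by linarith)
  unfold z
  rw [le_div_iff₀ hL₂]
  nlinarith

/-- A prime of `𝓡_m`-type (`p > z`) is `> w`, hence coprime to `P_w`, for large `x`.
[cite: Maynard2016LargeGaps, Lemma 7 (proof, «(p₀ + (h_i − h) q, P_w) = (p₀, P_w) = 1»)] -/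
theorem coprime_Pw_of_prime_gt_z {p x : ℕ} (hp : p.Prime) (hz : z x < p) (hwz : wFun x ≤ z x) :
    Nat.Coprime p (Pw x) :=
  coprime_Pw_of_prime_gt hp (lt_of_le_of_lt hwz hz)

/-- `U > 0` once `C_U > 0`, `x > 0`, `log y > 0`, `log₂ x > 0`. [cite: Maynard2016LargeGaps, §2 display (2.1)] -/
theorem U_pos {C_U ε : ℝ} (hCU : 0 < C_U) {x : ℕ} (hx : 0 < x) (hly : 0 < Real.log (y ε x))
    (hL₂ : 0 < Real.log (Real.log x)) : 0 < U C_U ε x := by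
  unfold U
  have : (0 : ℝ) < x := by exact_mod_cast hx
  positivity

/-- **W-trick package**: for `0 < ε ≤ 1/2` and all large `x`: `1 ≤ log₃ x`, `0 < log y`,
`w + 1 ≤ y`, `w ≤ z`, `P_w ∣ P_y`, `P_w ≤ (log₃ x)³ ≤ (log₂ x)³`. [cite: Maynard2016LargeGaps, §2 display (2.1), §4] -/
theorem eventually_wTrick {ε : ℝ} (hε : ε ≤ 1 / 2) :
    ∀ᶠ x : ℕ in atTop, 1 ≤ Real.log (Real.log (Real.log x)) ∧ 0 < Real.log (y ε x) ∧
      wFun x + 1 ≤ y ε x ∧ wFun x ≤ z x ∧ Pw x ∣ primorial ⌊y ε x⌋₊ ∧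
      (Pw x : ℝ) ≤ (Real.log (Real.log (Real.log x))) ^ 3 := by
  filter_upwards [eventually_iteratedLogs] with x hx
  obtain ⟨hL, hL₂, hL₃, hL₃L₂, hL₂L, -, hsq⟩ := hx
  have hL₂0 : 0 < Real.log (Real.log x) := by linarith
  have hL₂L' : Real.log (Real.log x) ≤ Real.log x := by linarith
  exact ⟨hL₃, log_y_pos hε hL₂0 hL₂L' hL₃, wFun_add_one_le_y hε hL₂0 hL₂L' hL₃,
    wFun_le_z hL₂0 (by linarith) hL₂L' hL₃ hsq, Pw_dvd_Py hε hL₂0 hL₂L' hL₃, Pw_le_log₃_pow hL₃⟩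

/-! ### The singular series and the main term of Lemma 6 are non-negative -/

/-- `ω_{m,q}(p) ≤ p`. [cite: Maynard2016LargeGaps, §5 display (5.1)] -/
theorem omegaMQ_le (k x m q p : ℕ) : omegaMQ k x m q p ≤ p := by
  unfold omegaMQ
  exact (Finset.card_filter_le _ _).trans (by simp)

/-- `𝔖_{m,q} ≥ 0`. [cite: Maynard2016LargeGaps, §5 display (5.2)] -/
theorem singSeriesMQ_nonneg (k : ℕ) (ε : ℝ) (x m q : ℕ) : 0 ≤ singSeriesMQ k ε x m q := by
  unfold singSeriesMQ
  refine Finset.prod_nonneg fun p hp => ?_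
  have hpP : p.Prime := (Finset.mem_filter.1 hp).2
  have hp0 : (0 : ℝ) < p := by exact_mod_cast hpP.pos
  have hp1 : (1 : ℝ) ≤ p := by exact_mod_cast hpP.one_le
  refine mul_nonneg ?_ (inv_nonneg.2 (pow_nonneg ?_ _))
  · rw [sub_nonneg, div_le_one hp0]
    exact_mod_cast omegaMQ_le k x m q p
  · rw [sub_nonneg, one_div_le hp0 one_pos, div_one]
    exact hp1

/-- The main term `M_{m,q}` of Lemma 6 is `≥ 0` once `U ≥ 0`, `log x ≥ 0`, `log y ≥ 0`.
[cite: Maynard2016LargeGaps, Lemma 6] -/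
theorem normMain_nonneg {k J : ℕ} {cj : Fin J → ℝ} {Fd : Fin k → Fin J → ℝ → ℝ} {G : ℝ → ℝ}
    {C_U ε : ℝ} {x m q : ℕ} (hU : 0 ≤ U C_U ε x) (hI1 : 0 ≤ I1 cj Fd) (hI2 : 0 ≤ I2 k G)
    (hL : 0 ≤ Real.log x) (hly : 0 ≤ Real.log (y ε x)) :
    0 ≤ normMain cj Fd G C_U ε x m q := by
  unfold normMain
  refine div_nonneg (mul_nonneg (mul_nonneg (mul_nonneg hU (singSeriesMQ_nonneg k ε x m q)) hI1)
    hI2) (mul_nonneg (mul_nonneg (Nat.cast_nonneg _) (pow_nonneg hL _)) (pow_nonneg hly _))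

end Maynard2016

end Literature.NumberTheory.Sieve
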